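import Mathlib
import Literature.Analysis.ODE.InverseSquareLadder
import Literature.Analysis.ODE.InverseSquareLadderAsymptotics
import Literature.Analysis.ODE.LadderIntertwine
import HarnessLib

/-!
# The boundary form of the Darboux ladder: `(L_n f)(L_n g) − f⁽ⁿ⁾ g⁽ⁿ⁾` is an exact derivative

Analysis/ODE support file (everything proved). For the ladder `L_n = ladder ι n` of
`InverseSquareLadder.lean` and a coefficient `ι` with the Riccati relation `ι' = −ι²` on an open set
`S` (e.g. `ι = 1/x` on `x > 0`), the bilinear expression `(L_n f)(L_n g) − f⁽ⁿ⁾g⁽ⁿ⁾` is, on `S`, the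
derivative of an explicit local bilinear form `ladderBdry ι n f g` in the jets of `f` and `g`
(`hasDerivAt_ladderBdry`), defined by the recursion

  `ladderBdry ι 0 f g = 0`,
  `ladderBdry ι (n+1) f g = (L_{n+1} f)(L_n g) − f⁽ⁿ⁺¹⁾ g⁽ⁿ⁾ − ladderBdry ι n (f'') g`

(so it involves `f` up to order `2n − 1` and `g` up to order `n`).  The inductive step is the
factorisation `L_{n+1} = (∂ − (n+1)ι) ∘ L_n` together with the spatial intertwining identity
`L_n ∘ ∂² = (∂² − n(n+1)ι²) ∘ L_n` (`Literature.Analysis.ODE.ladder_intertwine`).  Integrated over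
an interval `[a, b] ⊆ S` this is the **isometry of the ladder up to boundary terms**,
`∫_a^b (L_n f)(L_n g) = ∫_a^b f⁽ⁿ⁾g⁽ⁿ⁾ + [ladderBdry ι n f g]_a^b` (`integral_ladder_mul_ladder_eq`):
the exact (`c = 1`) form of the Hardy-chain coercivity of `InverseSquareLadderCoercivity.lean`,
i.e. the 1-D form of the isometry of the Hankel-type intertwiner between the free and the
`ℓ(ℓ+1)/x²` radial wave equations in odd dimension (Kenig–Lawrie–Liu–Schlag 2015, §2).  It is the
algebraic core of the odd-dimensional exterior-energy identity with apex at the centre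
(Duyckaerts–Kenig–Merle), route PhotonSphereChannels, `WindowedShellChannels`
(stmt-FinalStateConjecture-14085), far side.  Folklore.
-/

noncomputable section

namespace Literature.Analysis.ODE

open Set Filter Topology

/-- The **boundary form of the ladder**: the local bilinear expression whose derivative is
`(ladder ι n f)(ladder ι n g) − f⁽ⁿ⁾ g⁽ⁿ⁾` (see `hasDerivAt_ladderBdry`). [cite: KenigEtAl2015, §2] -/
def ladderBdry (ι : ℝ → ℝ) : ℕ → (ℝ → ℝ) → (ℝ → ℝ) → ℝ → ℝ
  | 0 => fun _ _ _ => 0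
  | n + 1 => fun f g x => ladder ι (n + 1) f x * ladder ι n g x
      - iteratedDeriv (n + 1) f x * iteratedDeriv n g x
      - ladderBdry ι n (iteratedDeriv 2 f) g x

variable {ι : ℝ → ℝ}

/-- `ladderBdry_zero`. [folklore] -/
@[simp] theorem ladderBdry_zero (f g : ℝ → ℝ) (x : ℝ) : ladderBdry ι 0 f g x = 0 := rfl

/-- `ladderBdry_succ`. [folklore] -/
theorem ladderBdry_succ (n : ℕ) (f g : ℝ → ℝ) (x : ℝ) :
    ladderBdry ι (n + 1) f g x = ladder ι (n + 1) f x * ladder ι n g x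
      - iteratedDeriv (n + 1) f x * iteratedDeriv n g x - ladderBdry ι n (iteratedDeriv 2 f) g x :=
  rfl

/-! ### The ladder of the zero function and locality -/

/-- The ladder of the zero function vanishes. [folklore] -/
theorem ladder_zero_fun (ι : ℝ → ℝ) (n : ℕ) : ladder ι n (fun _ : ℝ => (0 : ℝ)) = fun _ => 0 := by
  induction n with
  | zero => rfl
  | succ n ih =>
    rw [ladder_succ, ih]
    funext x
    simp [ladderStep_apply]

/-- The boundary form vanishes when the first argument is the zero function. [folklore] -/
theorem ladderBdry_zero_left (ι : ℝ → ℝ) (n : ℕ) (g : ℝ → ℝ) (x : ℝ) :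
    ladderBdry ι n (fun _ : ℝ => (0 : ℝ)) g x = 0 := by
  induction n generalizing x with
  | zero => rfl
  | succ n ih =>
    have h2 : iteratedDeriv 2 (fun _ : ℝ => (0 : ℝ)) = fun _ => 0 := by
      funext y; simp
    rw [ladderBdry_succ, ladder_zero_fun, h2, ih]
    simp

/-- **Locality of the boundary form**: it only sees `ι`, `f`, `g` near the point. [folklore] -/
theorem ladderBdry_congr_eventuallyEq {ι₁ ι₂ f₁ f₂ g₁ g₂ : ℝ → ℝ} (n : ℕ) {x : ℝ}
    (hι : ι₁ =ᶠ[𝓝 x] ι₂) (hf : f₁ =ᶠ[𝓝 x] f₂) (hg : g₁ =ᶠ[𝓝 x] g₂) :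
    ladderBdry ι₁ n f₁ g₁ x = ladderBdry ι₂ n f₂ g₂ x := by
  induction n generalizing f₁ f₂ x with
  | zero => rfl
  | succ n ih =>
    rw [ladderBdry_succ, ladderBdry_succ]
    have h1 : ladder ι₁ (n + 1) f₁ x = ladder ι₂ (n + 1) f₂ x :=
      ((ladder_eventuallyEq_of_iota hι (n + 1) f₁).trans (ladder_eventuallyEq hf (n + 1))).eq_of_nhds
    have h2 : ladder ι₁ n g₁ x = ladder ι₂ n g₂ x :=
      ((ladder_eventuallyEq_of_iota hι n g₁).trans (ladder_eventuallyEq hg n)).eq_of_nhds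
    have h3 : iteratedDeriv (n + 1) f₁ x = iteratedDeriv (n + 1) f₂ x := hf.iteratedDeriv_eq _
    have h4 : iteratedDeriv n g₁ x = iteratedDeriv n g₂ x := hg.iteratedDeriv_eq _
    have hf2 : iteratedDeriv 2 f₁ =ᶠ[𝓝 x] iteratedDeriv 2 f₂ := by
      have h' : ∀ᶠ y in 𝓝 x, f₁ =ᶠ[𝓝 y] f₂ := hf.eventually_nhds
      filter_upwards [h'] with y hy using hy.iteratedDeriv_eq 2
    rw [h1, h2, h3, h4, ih hι hf2 hg]

/-! ### Calculus of iterated derivatives -/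

/-- `iteratedDeriv n (iteratedDeriv k f) = iteratedDeriv (n + k) f`. [folklore] -/
theorem iteratedDeriv_iteratedDeriv (n k : ℕ) (f : ℝ → ℝ) :
    iteratedDeriv n (iteratedDeriv k f) = iteratedDeriv (n + k) f := by
  rw [iteratedDeriv_eq_iterate, iteratedDeriv_eq_iterate, iteratedDeriv_eq_iterate,
    Function.iterate_add_apply]

/-- `f ∈ C^{m+k}` ⇒ `iteratedDeriv k f ∈ C^m`. [folklore] -/
theorem contDiff_iteratedDeriv_of_add {m k : ℕ} {f : ℝ → ℝ}
    (hf : ContDiff ℝ ((m + k : ℕ) : ℕ∞) f) : ContDiff ℝ m (iteratedDeriv k f) := by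
  rw [iteratedDeriv_eq_iterate]
  have : ContDiff ℝ ((m : ℕ∞) + (k : ℕ∞)) f := by exact_mod_cast hf
  exact_mod_cast ContDiff.iterate_deriv' m k this

/-- `f ∈ C^N`, `k < N` ⇒ `iteratedDeriv k f` has derivative `iteratedDeriv (k+1) f`. [folklore] -/
theorem hasDerivAt_iteratedDeriv_of_lt {N k : ℕ} {f : ℝ → ℝ} (hf : ContDiff ℝ N f) (hk : k < N)
    (x : ℝ) : HasDerivAt (iteratedDeriv k f) (iteratedDeriv (k + 1) f x) x := by
  have hd : Differentiable ℝ (iteratedDeriv k f) :=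
    hf.differentiable_iteratedDeriv k (by exact_mod_cast hk)
  rw [iteratedDeriv_succ]
  exact (hd x).hasDerivAt

/-! ### The differential identity -/

/-- The intertwining identity at every level `n`, under the regularity available in the recursion
(`f ∈ C^{2n+2}`; for `n = 0` it is trivial). [folklore] -/
theorem ladder_intertwine' (hι : ContDiff ℝ (⊤ : ℕ∞) ι) {S : Set ℝ} (hS : IsOpen S)
    (hι' : ∀ x ∈ S, deriv ι x = -(ι x) ^ 2) (n : ℕ) {f : ℝ → ℝ}
    (hf : ContDiff ℝ ((2 * n + 2 : ℕ) : ℕ∞) f) {x : ℝ} (hx : x ∈ S) :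
    ladder ι n (iteratedDeriv 2 f) x
      = iteratedDeriv 2 (ladder ι n f) x - n * (n + 1) * ι x ^ 2 * ladder ι n f x := by
  rcases Nat.eq_zero_or_pos n with rfl | hn
  · simp
  · have hf' : ContDiff ℝ ((n + 3 : ℕ) : ℕ∞) f :=
      hf.of_le (by exact_mod_cast (by omega : n + 3 ≤ 2 * n + 2))
    exact ladder_intertwine hι hS hι' hf' hx

/-- **The ladder product minus the top-derivative product is the derivative of the boundary form.**
On an open set `S` where `ι' = −ι²`, for `f ∈ C^{2n}` and `g ∈ C^{n+1}`:
`(ladderBdry ι n f g)' = (ladder ι n f)(ladder ι n g) − f⁽ⁿ⁾ g⁽ⁿ⁾` on `S`.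
[cite: KenigEtAl2015, §2] -/
theorem hasDerivAt_ladderBdry (hι : ContDiff ℝ (⊤ : ℕ∞) ι) {S : Set ℝ} (hS : IsOpen S)
    (hι' : ∀ x ∈ S, deriv ι x = -(ι x) ^ 2) :
    ∀ (n : ℕ) {f g : ℝ → ℝ}, ContDiff ℝ ((2 * n : ℕ) : ℕ∞) f → ContDiff ℝ ((n + 1 : ℕ) : ℕ∞) g →
      ∀ x ∈ S, HasDerivAt (ladderBdry ι n f g)
        (ladder ι n f x * ladder ι n g x - iteratedDeriv n f x * iteratedDeriv n g x) x := by
  intro n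
  induction n with
  | zero =>
    intro f g _ _ x _
    have : ladder ι 0 f x * ladder ι 0 g x - iteratedDeriv 0 f x * iteratedDeriv 0 g x = 0 := by
      simp
    rw [this]
    exact hasDerivAt_const x 0
  | succ n ih =>
    intro f g hf hg x hx
    -- the players
    set u : ℝ → ℝ := ladder ι n f with hu
    set v : ℝ → ℝ := ladder ι n g with hv
    set c : ℝ := (n : ℝ) + 1 with hc
    have hf2n : ContDiff ℝ ((2 * n : ℕ) : ℕ∞) (iteratedDeriv 2 f) := by
      refine contDiff_iteratedDeriv_of_add ?_
      have : 2 * n + 2 = 2 * (n + 1) := by ring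
      rw [this]; exact hf
    have hgn : ContDiff ℝ ((n + 1 : ℕ) : ℕ∞) g := hg.of_le (by exact_mod_cast Nat.le_succ _)
    -- regularity of `u`, `v`
    have huC : ContDiff ℝ ((n + 2 : ℕ) : ℕ∞) u := by
      refine contDiff_ladder hι (m := n + 2) ?_
      have : n + 2 + n = 2 * (n + 1) := by ring
      rw [this]; exact hf
    have hvC : ContDiff ℝ ((2 : ℕ) : ℕ∞) v := by
      refine contDiff_ladder hι (m := 2) ?_
      have : 2 + n = n + 1 + 1 := by ring
      rw [this]; exact hg
    have hu2 : ContDiff ℝ 2 u :=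
      huC.of_le (WithTop.coe_le_coe.mpr (by exact_mod_cast (by omega : 2 ≤ n + 2)))
    have hv2 : ContDiff ℝ 2 v := by exact_mod_cast hvC
    have hud : Differentiable ℝ u := hu2.differentiable (by norm_num)
    have hvd : Differentiable ℝ v := hv2.differentiable (by norm_num)
    have hud' : Differentiable ℝ (deriv u) := by
      have := (contDiff_succ_iff_deriv.1 (show ContDiff ℝ (1 + 1) u from hu2)).2.2
      exact this.differentiable (by norm_num)
    have hιd : Differentiable ℝ ι := hι.differentiable (by simp)
    -- induction hypothesis for `(f'', g)`
    have IH := ih hf2n hgn x hx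
    -- intertwining and the iterated-derivative bookkeeping
    have hinter : ladder ι n (iteratedDeriv 2 f) x = iteratedDeriv 2 u x - n * (n + 1) * ι x ^ 2 * u x :=
      ladder_intertwine' hι hS hι' n hf hx
    have hitf : iteratedDeriv n (iteratedDeriv 2 f) x = iteratedDeriv (n + 2) f x := by
      rw [iteratedDeriv_iteratedDeriv]
    -- derivative of `w = ladder ι (n+1) f = u' − c ι u`
    have hw_def : ladder ι (n + 1) f = fun y => deriv u y - c * ι y * u y := by
      funext y; rw [ladder_succ, ladderStep_apply]; push_cast; rfl
    have hw : HasDerivAt (ladder ι (n + 1) f)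
        (iteratedDeriv 2 u x + c * ι x ^ 2 * u x - c * ι x * deriv u x) x := by
      rw [hw_def]
      have h1 : HasDerivAt (deriv u) (iteratedDeriv 2 u x) x := by
        rw [iteratedDeriv_succ, iteratedDeriv_one]; exact (hud' x).hasDerivAt
      have h2 : HasDerivAt (fun y => c * ι y * u y) (c * (deriv ι x * u x + ι x * deriv u x)) x := by
        have := ((hιd x).hasDerivAt.fun_mul (hud x).hasDerivAt).const_mul c
        simpa [mul_assoc] using this
      refine (h1.fun_sub h2).congr_deriv ?_
      rw [hι' x hx]; ring
    -- derivative of `v = ladder ι n g`, rewritten through `ladder ι (n+1) g`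
    have hv' : HasDerivAt v (ladder ι (n + 1) g x + c * ι x * v x) x := by
      refine (hvd x).hasDerivAt.congr_deriv ?_
      rw [ladder_succ, ladderStep_apply]; push_cast; ring
    -- derivatives of the iterated derivatives
    have hF : HasDerivAt (iteratedDeriv (n + 1) f) (iteratedDeriv (n + 2) f x) x :=
      hasDerivAt_iteratedDeriv_of_lt hf (by omega) x
    have hG : HasDerivAt (iteratedDeriv n g) (iteratedDeriv (n + 1) g x) x :=
      hasDerivAt_iteratedDeriv_of_lt hg (by omega) x
    -- assemble
    have hfun : ladderBdry ι (n + 1) f g = fun y => ladder ι (n + 1) f y * v y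
        - iteratedDeriv (n + 1) f y * iteratedDeriv n g y - ladderBdry ι n (iteratedDeriv 2 f) g y := by
      funext y; rw [ladderBdry_succ]
    rw [hfun]
    refine (((hw.fun_mul hv').fun_sub (hF.fun_mul hG)).fun_sub IH).congr_deriv ?_
    rw [hinter, hitf]
    have hwx : ladder ι (n + 1) f x = deriv u x - c * ι x * u x := by rw [hw_def]
    rw [hwx]
    show (iteratedDeriv 2 u x + c * ι x ^ 2 * u x - c * ι x * deriv u x) * v x +
        (deriv u x - c * ι x * u x) * (ladder ι (n + 1) g x + c * ι x * v x) -
        (iteratedDeriv (n + 2) f x * iteratedDeriv n g x +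
          iteratedDeriv (n + 1) f x * iteratedDeriv (n + 1) g x) -
        ((iteratedDeriv 2 u x - n * (n + 1) * ι x ^ 2 * u x) * v x -
          iteratedDeriv (n + 2) f x * iteratedDeriv n g x) =
      (deriv u x - c * ι x * u x) * ladder ι (n + 1) g x -
        iteratedDeriv (n + 1) f x * iteratedDeriv (n + 1) g x
    rw [hc]; ring

/-- **Isometry of the ladder up to boundary terms.** On an interval `[a, b]` contained in an open
set `S` where `ι' = −ι²`, for `f ∈ C^{2n}`, `g ∈ C^{n+1}`:
`∫_a^b (ladder ι n f)(ladder ι n g) − f⁽ⁿ⁾g⁽ⁿ⁾ = ladderBdry ι n f g b − ladderBdry ι n f g a`.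
[cite: KenigEtAl2015, §2] -/
theorem integral_ladder_mul_ladder_sub_eq (hι : ContDiff ℝ (⊤ : ℕ∞) ι) {S : Set ℝ} (hS : IsOpen S)
    (hι' : ∀ x ∈ S, deriv ι x = -(ι x) ^ 2) (n : ℕ) {f g : ℝ → ℝ}
    (hf : ContDiff ℝ ((2 * n : ℕ) : ℕ∞) f) (hg : ContDiff ℝ ((n + 1 : ℕ) : ℕ∞) g) {a b : ℝ}
    (hab : a ≤ b) (hS' : Icc a b ⊆ S) :
    ∫ x in a..b, (ladder ι n f x * ladder ι n g x - iteratedDeriv n f x * iteratedDeriv n g x)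
      = ladderBdry ι n f g b - ladderBdry ι n f g a := by
  have hderiv : ∀ x ∈ uIcc a b, HasDerivAt (ladderBdry ι n f g)
      (ladder ι n f x * ladder ι n g x - iteratedDeriv n f x * iteratedDeriv n g x) x := by
    intro x hx
    rw [uIcc_of_le hab] at hx
    exact hasDerivAt_ladderBdry hι hS hι' n hf hg x (hS' hx)
  -- continuity of the integrand
  have hfn : n + n = 2 * n := by ring
  have hLf : Continuous (ladder ι n f) :=
    (contDiff_ladder hι (m := n) (by rw [hfn]; exact hf)).continuous
  have hLg : Continuous (ladder ι n g) :=
    (contDiff_ladder hι (m := 1) (by rw [add_comm]; exact hg)).continuous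
  have hDf : Continuous (iteratedDeriv n f) :=
    hf.continuous_iteratedDeriv n (by exact_mod_cast (by omega : n ≤ 2 * n))
  have hDg : Continuous (iteratedDeriv n g) :=
    hg.continuous_iteratedDeriv n (by exact_mod_cast (by omega : n ≤ n + 1))
  have hcont : Continuous fun x =>
      ladder ι n f x * ladder ι n g x - iteratedDeriv n f x * iteratedDeriv n g x :=
    (hLf.mul hLg).sub (hDf.mul hDg)
  exact intervalIntegral.integral_eq_sub_of_hasDerivAt hderiv (hcont.intervalIntegrable _ _)

end Literature.Analysis.ODE
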